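import Summits.ResolutionOfSingularities.ResolutionOfSingularities.Theorems.WeightedInvariantIota3SecondMemberDominance
import Summits.ResolutionOfSingularities.ResolutionOfSingularities.Theorems.WeightedInvariantIota3DominanceWordResidue
import Summits.ResolutionOfSingularities.ResolutionOfSingularities.Theorems.WeightedInvariantKeyRungThreeOfDominance
import HarnessLib

/-!
# THE DOMINANCE WORD, (σ-pres)₃ and the rung clause (open″)≤3 `JOpenPresentationForallSingLE 3 p ι₃ᵗ J₃ᵗ` — UNCONDITIONAL BY NAME
# (door `HypersurfaceCentreConstruction`, stmt-ResolutionOfSingularities-19897; memos RESIDUE-PLAN.md, LEMMA-C-PRIME.md)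

Helper for `stub_keyRungGrHomLE_three` (def-free, `--supports 19897`).  With the second-member dominance theorem proved outright
(`Iota3.secondMember_mem`, …Iota3SecondMemberDominance ← LEMMA C′), the chain of SPEC (Δ12) closes by name:
* **`Iota3.twoFlagDominanceAtLevelAt_holds`** — the dominance word `TwoFlagDominanceAtLevelAt f` at EVERY regular local ring of Krull
  dimension `3` and every `0 ≠ f ∈ 𝔪` (`twoFlagDominanceAtLevelAt_of_residue`);
* **`twoFlagDominanceAtLevelLE3Body_holds : TwoFlagDominanceAtLevelLE3Body p`** (every `p`);
* **`sigmaPresentationLE3Body_holds : SigmaPresentationLE3Body p`** ((σ-pres)₃, `sigmaPresentationLE3_of_dominance`);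
* **`pointBodyLE3_zero_zero`, `pointBodyLE3_zero_one`** (the ISOLATED and TIE point bodies of the (open″)≤3 assembly);
* **`jOpenPresentationForallSingLE_three : JOpenPresentationForallSingLE 3 p iotaFlatT jFlatT`** — the rung clause h8 = (open″)≤3 for the
  pair of record, UNCONDITIONAL (`jOpenPresentationForallSingLE_three_of_dominance`).
[OURS · L1 W4.3; AI work, weaker than expert review; nothing here is a statement of the manuscript under review.]
-/

noncomputable section

set_option linter.dupNamespace false -- mandated namespace of this single-conjunct summit

open IsLocalRing Literature.AlgebraicGeometry.Resolution
open Summit.ResolutionOfSingularities.ResolutionOfSingularities.Theorems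
open Summit.ResolutionOfSingularities.ResolutionOfSingularities.Theorems.JOpenLE3

namespace Summit.ResolutionOfSingularities.ResolutionOfSingularities.Cruxes.HypersurfaceCentreConstruction.LocalEngine

namespace Iota3

/-- **THE DOMINANCE WORD AT EVERY POSITION**: `TwoFlagDominanceAtLevelAt f` for every regular local ring `S` of Krull dimension `3` and every
`0 ≠ f ∈ 𝔪_S` (`twoFlagDominanceAtLevelAt_of_residue` with the residue supplied by `secondMember_mem`). [OURS · L1 W4.3 · (Δ12)] -/
theorem twoFlagDominanceAtLevelAt_holds {S : Type} [CommRing S] [IsRegularLocalRing S] (hdim : ringKrullDim S = (3 : ℕ)) {f : S}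
    (hf0 : f ≠ 0) (hfm : f ∈ maximalIdeal S) : TwoFlagDominanceAtLevelAt f :=
  twoFlagDominanceAtLevelAt_of_residue hdim hf0 hfm
    fun _ _ hb hbound _ _ _ _ _ _ _ hadm hab hq₂ hr hΦ hΦ' hF hF' =>
      secondMember_mem hdim hf0 hfm hb hbound hadm hab hq₂ hr hΦ hΦ' hF hF'

end Iota3

open Iota3

/-- **`TwoFlagDominanceAtLevelLE3Body p` HOLDS** (every `p`; the position hypotheses of the body are not even needed). [OURS · L1 W4.3 · (Δ12)] -/
theorem twoFlagDominanceAtLevelLE3Body_holds (p : ℕ) : TwoFlagDominanceAtLevelLE3Body p :=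
  fun _ _ _ _ _ _ _ _ _ _ hdim hf0 hf2 _ _ =>
    twoFlagDominanceAtLevelAt_holds hdim hf0 (Ideal.pow_le_self two_ne_zero hf2)

/-- **(σ-pres)₃ `SigmaPresentationLE3Body p` HOLDS.** [OURS · L1 W4.3 · (Δ12)] -/
theorem sigmaPresentationLE3Body_holds (p : ℕ) : SigmaPresentationLE3Body p :=
  sigmaPresentationLE3_of_dominance p (twoFlagDominanceAtLevelLE3Body_holds p)

/-- **The ISOLATED point body (P₀₀) of the (open″)≤3 assembly HOLDS.** [OURS · L1 W4.3 · (o52-asm)] -/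
theorem pointBodyLE3_zero_zero (p : ℕ) : PointBodyLE3 p 0 0 :=
  (pointBodyLE3_zero_of_sigmaPresentation p (sigmaPresentationLE3Body_holds p)).1

/-- **The TIE point body (P₀₁) of the (open″)≤3 assembly HOLDS.** [OURS · L1 W4.3 · (o52-asm)] -/
theorem pointBodyLE3_zero_one (p : ℕ) : PointBodyLE3 p 0 1 :=
  (pointBodyLE3_zero_of_sigmaPresentation p (sigmaPresentationLE3Body_holds p)).2

/-- **THE RUNG CLAUSE (open″)≤3 FOR THE PAIR OF RECORD, UNCONDITIONAL**: `JOpenPresentationForallSingLE 3 p iotaFlatT jFlatT` for every `p`.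
[OURS · L1 W4.3 · (o52-asm)/(Δ12)] -/
theorem jOpenPresentationForallSingLE_three (p : ℕ) : JOpenPresentationForallSingLE 3 p iotaFlatT jFlatT :=
  jOpenPresentationForallSingLE_three_of_dominance p (twoFlagDominanceAtLevelLE3Body_holds p)

end Summit.ResolutionOfSingularities.ResolutionOfSingularities.Cruxes.HypersurfaceCentreConstruction.LocalEngine

end
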